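import Summits.QuantumFields.YangMills.Theorems.AlphaInputsT3ACv4Lane
import Summits.QuantumFields.YangMills.Theorems.AlphaInputsT3ACv3Chi
import HarnessLib

/-!
# `AlphaInputsT3ACv4Chi` — THE VERSION-4 χ-SOCKET AT THE T³ OBJECTS: `OfV4ChiAt` ∕ `AlphaInputsT3ACv4RecChi L` (the text of the future skeleton v5p10's stub
# `stub_laneRecordsV4Chi`), the package `PkgAtV4Chi`, and VERSION 3 ⇒ VERSION 4 for the records (★★OWNER RULING g26-№14, plan §7 P2) — lane `pub-balaban3d`,
# width seat alpha-2 (g7)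

WHY (cell `ym3-torus`, route `UnitScaleTilt`, crux `HistoryTailL` = stmt-QuantumFields-19936; bill v1.2 §7).  `AlphaInputsT3ACv3Chi`'s texts VERBATIM with the run package
`AlphaV3AC.RunAlphaV3ChiAC ↦ AlphaV4AC.RunAlphaV4ChiAC` (`…v4Lane`: the comb (67)-row `hLF67` replaced by the currency-free (71)-row `h71`):
* §1 `AlphaInputsT3AC.OfV4ChiAt F 𝔠 a₀ a₁` (hypothesis schema), `AlphaInputsT3ACv4RecChi L` (the record-parametric v4 χ-socket = the v5p10 stub text, LEAD's later crux-workfile act).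
* §2 `AlphaInputsT3AC.PkgAtV4Chi` (the package's data at `(γ, K)`: `PkgAtV3Chi`'s fields with `run : RunAlphaV4ChiAC`), the chooser `OfV4ChiAt.pkgAtV4Chi` with `pkgAtV4Chi_a₀∕_a₁`.
* §3 v3 ⇒ v4 (nothing landed is lost): `PkgAtV3Chi.toV4` (run by `RunAlphaV3ChiAC.toV4_T3`), ★ `AlphaInputsT3AC.ofV4ChiAt_of_v3`, ★ `alphaInputsT3ACv4RecChi_of_v3 : AlphaInputsT3ACv3RecChi L →
  AlphaInputsT3ACv4RecChi L`.
The (41)-side API (`PkgCoreRows`, P3) and the HistoryTail door over it (P5–P20) are the next files of the plan; the v3 package, records and doors stay in the tree unchanged.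
HONEST FRAMING.  `def … : Prop` below are HYPOTHESIS SCHEMAS, OPEN, never asserted; the theorems are field bookkeeping; nothing of [Balaban1985UV3]'s cluster expansion or of
[Balaban1985Variational] Thm 1 is proved.  Count-neutral helper toward 2′χ (`--supports stmt-QuantumFields-19936`); registry untouched.  YM₃ on the three-torus is rung R3 of the
programme, not the Clay problem: nothing here is about d = 4, infinite volume, or a mass gap.

References: T. Bałaban, Commun. Math. Phys. 102 (1985) 255–275 [Balaban1985UV3] ((7) p.257, (40)–(41) p.266, (47) p.267, (67)–(71) p.273, Thm 2 p.272); Commun. Math. Phys. 102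
(1985) 277–309 [Balaban1985Variational] (Thm 1 (8) p.279).
-/

set_option autoImplicit false

noncomputable section

namespace Summit.QuantumFields.YangMills.Theorems

open MeasureTheory
open scoped BigOperators
open Literature.MathematicalPhysics.QuantumFieldTheory.Balaban1983to89
open Literature.MathematicalPhysics.QuantumFieldTheory.Balaban1983to89.T3ContinuumYM3Torus
open Literature.MathematicalPhysics.QuantumFieldTheory.Balaban1983to89.T3UnitLawDensityEML (ℰp)
open Literature.MathematicalPhysics.QuantumFieldTheory.Balaban1983to89.T3UnitScaleTilt (θBal)
open Literature.MathematicalPhysics.QuantumFieldTheory.Balaban1985CMP102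
open Literature.MathematicalPhysics.QuantumFieldTheory.Balaban1985CMP102.Setting
open Summit.QuantumFields.Balaban3D.Carriers
open Summit.QuantumFields.Balaban3D.Proofs.Primitives
open Summit.QuantumFields.Balaban3D.Proofs.GroupModelLieC (lieC)
open Summit.QuantumFields.Balaban3D.Proofs.TowerAC
open Summit.QuantumFields.Balaban3D.Proofs.StandardAC
open Summit.QuantumFields.Balaban3D.Proofs.InputsAC
open Summit.QuantumFields.Balaban3D.Proofs.AlphaAC (AlphaDataAC)
open Summit.QuantumFields.YangMills.Theorems.AlphaV3AC
open Summit.QuantumFields.YangMills.Theorems.AlphaV4AC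

/-! ## §1 The v4 χ-socket at given constants and the record-parametric closed proposition -/

/-- **(α) AT THE T³ OBJECTS, VERSION 4 (currency-free (71) row), WITH PRINT'S LOWER ROW, AT GIVEN [7] CONSTANTS `a₀, a₁`** (hypothesis schema, OPEN, never asserted):
`AlphaInputsT3AC.OfV3ChiAt`'s text with `RunAlphaV3ChiAC ↦ RunAlphaV4ChiAC`. [cite: Balaban1985UV3, Thm 2 p.272 + (40)–(41) p.266 + (47) p.267 + (71) p.273; Balaban1985Variational, Thm 1 (8) p.279] -/
def AlphaInputsT3AC.OfV4ChiAt (F : T3Family) (𝔠 : AlphaConsts F.L (suGroupModel 2).N) (a₀ a₁ : ℝ) : Prop :=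
  ∀ (γ : ℝ) (hγ : 0 < γ) (hγ1 : γ ≤ (min 𝔠.gamma0 1) ^ 2) (K : ℕ),
    ∃ (reg : ℕ → Set (GaugeField (F.P K) 0 (Matrix.specialUnitaryGroup (Fin 2) ℂ)))
      (Uk : (k : ℕ) → GaugeField (F.P K) (k + 1) (Matrix.specialUnitaryGroup (Fin 2) ℂ) →
        GaugeField (F.P K) 0 (Matrix.specialUnitaryGroup (Fin 2) ℂ))
      (UkH : (k : ℕ) → Hist (F.P K) k → GaugeField (F.P K) k (Matrix.specialUnitaryGroup (Fin 2) ℂ) →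
        GaugeField (F.P K) 0 (Matrix.specialUnitaryGroup (Fin 2) ℂ))
      (hU0 : ∀ V : GaugeField (F.P K) 0 (Matrix.specialUnitaryGroup (Fin 2) ℂ), UkH 0 (Hist.triv (F.P K) 0) V = V)
      (hUs : ∀ (k : ℕ) (V : GaugeField (F.P K) (k + 1) (Matrix.specialUnitaryGroup (Fin 2) ℂ)),
        UkH (k + 1) (Hist.triv (F.P K) (k + 1)) V = Uk k V)
      (𝔖 : ∀ k, StepSeries (T3Scales F γ hγ (hγ1.trans (sq_min_one_le _ 𝔠.gamma0_pos)) K)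
        (Matrix.specialUnitaryGroup (Fin 2) ℂ) ↥(lieC (suGroupModel 2))
        (nblkOf (T3Scales F γ hγ (hγ1.trans (sq_min_one_le _ 𝔠.gamma0_pos)) K) 𝔠.lane.carrier k) k)
      (𝔄 : AlphaDataAC (suGroupModel 2) 𝔠
        (XT3 F γ hγ (hγ1.trans (sq_min_one_le _ 𝔠.gamma0_pos)) K reg Uk UkH hU0 hUs) 𝔖),
      RunAlphaV4ChiAC (suGroupModel 2) 𝔠 (XT3 F γ hγ (hγ1.trans (sq_min_one_le _ 𝔠.gamma0_pos)) K reg Uk UkH hU0 hUs) 𝔖 𝔄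
          (AlphaInputsT3AC.admWindowT3 F 𝔠 γ hγ hγ1 K) ∧
        MinimiserRowsT3 F 𝔠 γ hγ hγ1 a₀ a₁ K UkH ∧
          TerminalRowsT3 F 𝔠 γ hγ hγ1 K (XT3 F γ hγ (hγ1.trans (sq_min_one_le _ 𝔠.gamma0_pos)) K reg Uk UkH hU0 hUs) 𝔖 (𝔄.cP K)

/-- **`AlphaInputsT3ACv4RecChi L` — THE RECORD-PARAMETRIC VERSION-4 χ-SOCKET** (hypothesis schema, OPEN, never asserted; the text the skeleton v5p10's stub `stub_laneRecordsV4Chi` will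
name, ★★OWNER RULING g26-№14 (b)): `AlphaInputsT3ACv3RecChi`'s text with `OfV3ChiAt ↦ OfV4ChiAt`. [cite: Balaban1985UV3, (7) p.257 and Thm 2 p.272; Balaban1985Variational, Thm 1 (8) p.279] -/
def AlphaInputsT3ACv4RecChi (L : ℕ) : Prop :=
  ∃ (b₁ p₁ : ℝ), ∀ (b₀ p₀ : ℝ), b₁ ≤ b₀ → p₁ ≤ p₀ →
    ∃ (𝔠 : AlphaConsts L (suGroupModel 2).N) (a₀ a₁ : ℝ), 𝔠.b₀ = b₀ ∧ 𝔠.p₀ = p₀ ∧ 0 < a₀ ∧ 0 < a₁ ∧ 𝔠.B₃ * a₁ ≤ a₀ ∧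
      ∀ (F : T3Family) (hF : F.L = L), AlphaInputsT3AC.OfV4ChiAt F (hF ▸ 𝔠) a₀ a₁

/-! ## §2 The v4 χ-package's data at `(γ, K)` -/

section Pkg

variable (F : T3Family) (𝔠 : AlphaConsts F.L (suGroupModel 2).N) (γ : ℝ) (hγ : 0 < γ) (hγ1 : γ ≤ (min 𝔠.gamma0 1) ^ 2) (K : ℕ)

/-- **THE v4 χ-PACKAGE'S DATA AT `(γ, K)`**: `AlphaInputsT3AC.PkgAtV3Chi`'s fields VERBATIM with `run : RunAlphaV4ChiAC …`. [cite: Balaban1985UV3, Thm 2 p.272 + (71) p.273; Balaban1985Variational, Thm 1 (8) p.279] -/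
structure AlphaInputsT3AC.PkgAtV4Chi where
  /-- regular classes of [Balaban1985Variational] -/
  reg : ℕ → Set (GaugeField (F.P K) 0 (Matrix.specialUnitaryGroup (Fin 2) ℂ))
  /-- minimizers `U_k(V)` -/
  Uk : (k : ℕ) → GaugeField (F.P K) (k + 1) (Matrix.specialUnitaryGroup (Fin 2) ℂ) →
    GaugeField (F.P K) 0 (Matrix.specialUnitaryGroup (Fin 2) ℂ)
  /-- composite minimizers `U_k(V, h)` of (42) -/
  UkH : (k : ℕ) → Hist (F.P K) k → GaugeField (F.P K) k (Matrix.specialUnitaryGroup (Fin 2) ℂ) →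
    GaugeField (F.P K) 0 (Matrix.specialUnitaryGroup (Fin 2) ℂ)
  /-- `U_0(V, triv) = V` -/
  hU0 : ∀ V : GaugeField (F.P K) 0 (Matrix.specialUnitaryGroup (Fin 2) ℂ), UkH 0 (Hist.triv (F.P K) 0) V = V
  /-- `U_{k+1}(V, triv) = U_k(V)` -/
  hUs : ∀ (k : ℕ) (V : GaugeField (F.P K) (k + 1) (Matrix.specialUnitaryGroup (Fin 2) ℂ)),
    UkH (k + 1) (Hist.triv (F.P K) (k + 1)) V = Uk k V
  /-- expansion data (chart values in `𝔰𝔲(2)ᶜ`) -/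
  𝔖 : ∀ k, StepSeries (T3Scales F γ hγ (hγ1.trans (sq_min_one_le _ 𝔠.gamma0_pos)) K) (Matrix.specialUnitaryGroup (Fin 2) ℂ)
    ↥(lieC (suGroupModel 2)) (nblkOf (T3Scales F γ hγ (hγ1.trans (sq_min_one_le _ 𝔠.gamma0_pos)) K) 𝔠.lane.carrier k) k
  /-- auxiliary (α) data -/
  𝔄 : AlphaDataAC (suGroupModel 2) 𝔠 (XT3 F γ hγ (hγ1.trans (sq_min_one_le _ 𝔠.gamma0_pos)) K reg Uk UkH hU0 hUs) 𝔖
  /-- the v4 χ-record's (α) rows hold for these data at the (40) windows -/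
  run : RunAlphaV4ChiAC (suGroupModel 2) 𝔠 (XT3 F γ hγ (hγ1.trans (sq_min_one_le _ 𝔠.gamma0_pos)) K reg Uk UkH hU0 hUs) 𝔖 𝔄
    (AlphaInputsT3AC.admWindowT3 F 𝔠 γ hγ hγ1 K)
  /-- the constant `a₀` of [Balaban1985Variational] Thm 1 -/
  a₀ : ℝ
  /-- the constant `a₁` of [Balaban1985Variational] Thm 1 -/
  a₁ : ℝ
  /-- `0 < a₀`, `0 < a₁`, `B₃a₁ ≤ a₀` -/
  consts_ok : 0 < a₀ ∧ 0 < a₁ ∧ 𝔠.B₃ * a₁ ≤ a₀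
  /-- the minimiser rows r1–r3 for `UkH` -/
  minRows : MinimiserRowsT3 F 𝔠 γ hγ hγ1 a₀ a₁ K UkH
  /-- the terminal data-regularity rows at `k = K` -/
  termRows : TerminalRowsT3 F 𝔠 γ hγ hγ1 K (XT3 F γ hγ (hγ1.trans (sq_min_one_le _ 𝔠.gamma0_pos)) K reg Uk UkH hU0 hUs) 𝔖 (𝔄.cP K)

variable {F 𝔠 γ hγ hγ1 K} {a₀ a₁ : ℝ}

/-- At given constants the v4 χ-record exists with `a₀, a₁` EQUAL to the given ones. [cite: Balaban1985UV3, Thm 2 p.272] -/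
theorem AlphaInputsT3AC.OfV4ChiAt.nonempty_pkgAtV4Chi (h : AlphaInputsT3AC.OfV4ChiAt F 𝔠 a₀ a₁) (hc : 0 < a₀ ∧ 0 < a₁ ∧ 𝔠.B₃ * a₁ ≤ a₀)
    (γ : ℝ) (hγ : 0 < γ) (hγ1 : γ ≤ (min 𝔠.gamma0 1) ^ 2) (K : ℕ) :
    Nonempty {p : AlphaInputsT3AC.PkgAtV4Chi F 𝔠 γ hγ hγ1 K // p.a₀ = a₀ ∧ p.a₁ = a₁} := by
  obtain ⟨reg, Uk, UkH, hU0, hUs, 𝔖, 𝔄, hR, hM, hT⟩ := h γ hγ hγ1 K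
  exact ⟨⟨⟨reg, Uk, UkH, hU0, hUs, 𝔖, 𝔄, hR, a₀, a₁, hc, hM, hT⟩, rfl, rfl⟩⟩

/-- **THE v4 χ-RECORD AT GIVEN CONSTANTS, CHOSEN** — its `a₀`, `a₁` ARE the given ones. [cite: Balaban1985UV3, Thm 2 p.272] -/
noncomputable def AlphaInputsT3AC.OfV4ChiAt.pkgAtV4Chi (h : AlphaInputsT3AC.OfV4ChiAt F 𝔠 a₀ a₁) (hc : 0 < a₀ ∧ 0 < a₁ ∧ 𝔠.B₃ * a₁ ≤ a₀)
    (γ : ℝ) (hγ : 0 < γ) (hγ1 : γ ≤ (min 𝔠.gamma0 1) ^ 2) (K : ℕ) :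
    AlphaInputsT3AC.PkgAtV4Chi F 𝔠 γ hγ hγ1 K :=
  (Classical.choice (h.nonempty_pkgAtV4Chi hc γ hγ hγ1 K)).1

/-- The chosen v4 record's `a₀` is the given `a₀`. [cite: Balaban1985Variational, Thm 1 (8) p.279] -/
theorem AlphaInputsT3AC.OfV4ChiAt.pkgAtV4Chi_a₀ (h : AlphaInputsT3AC.OfV4ChiAt F 𝔠 a₀ a₁) (hc : 0 < a₀ ∧ 0 < a₁ ∧ 𝔠.B₃ * a₁ ≤ a₀)
    (γ : ℝ) (hγ : 0 < γ) (hγ1 : γ ≤ (min 𝔠.gamma0 1) ^ 2) (K : ℕ) :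
    (h.pkgAtV4Chi hc γ hγ hγ1 K).a₀ = a₀ :=
  (Classical.choice (h.nonempty_pkgAtV4Chi hc γ hγ hγ1 K)).2.1

/-- The chosen v4 record's `a₁` is the given `a₁`. [cite: Balaban1985Variational, Thm 1 (7)-(8) p.279] -/
theorem AlphaInputsT3AC.OfV4ChiAt.pkgAtV4Chi_a₁ (h : AlphaInputsT3AC.OfV4ChiAt F 𝔠 a₀ a₁) (hc : 0 < a₀ ∧ 0 < a₁ ∧ 𝔠.B₃ * a₁ ≤ a₀)
    (γ : ℝ) (hγ : 0 < γ) (hγ1 : γ ≤ (min 𝔠.gamma0 1) ^ 2) (K : ℕ) :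
    (h.pkgAtV4Chi hc γ hγ hγ1 K).a₁ = a₁ :=
  (Classical.choice (h.nonempty_pkgAtV4Chi hc γ hγ hγ1 K)).2.2

/-! ## §3 Version 3 ⇒ version 4 for the χ-package and the records (nothing landed is lost) -/

/-- **THE v3 χ-PACKAGE UPGRADES TO THE v4 χ-PACKAGE** (`run ↦ run.toV4_T3`, every other field kept). [cite: Balaban1985UV3, (67)–(71) p.273] -/
def AlphaInputsT3AC.PkgAtV3Chi.toV4 (p : AlphaInputsT3AC.PkgAtV3Chi F 𝔠 γ hγ hγ1 K) : AlphaInputsT3AC.PkgAtV4Chi F 𝔠 γ hγ hγ1 K where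
  reg := p.reg
  Uk := p.Uk
  UkH := p.UkH
  hU0 := p.hU0
  hUs := p.hUs
  𝔖 := p.𝔖
  𝔄 := p.𝔄
  run := p.run.toV4_T3 (hγ1 := hγ1)
  a₀ := p.a₀
  a₁ := p.a₁
  consts_ok := p.consts_ok
  minRows := p.minRows
  termRows := p.termRows

end Pkg

/-- ★ **v3 ⇒ v4 AT GIVEN CONSTANTS**: `OfV3ChiAt F 𝔠 a₀ a₁ → OfV4ChiAt F 𝔠 a₀ a₁` (the run package upgrades by `RunAlphaV3ChiAC.toV4_T3`, i.e. by (69)–(71); data unchanged).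
[cite: Balaban1985UV3, (67)–(71) p.273 + Thm 2 p.272] -/
theorem AlphaInputsT3AC.ofV4ChiAt_of_v3 {F : T3Family} {𝔠 : AlphaConsts F.L (suGroupModel 2).N} {a₀ a₁ : ℝ} (h : AlphaInputsT3AC.OfV3ChiAt F 𝔠 a₀ a₁) :
    AlphaInputsT3AC.OfV4ChiAt F 𝔠 a₀ a₁ := by
  intro γ hγ hγ1 K
  obtain ⟨reg, Uk, UkH, hU0, hUs, 𝔖, 𝔄, hR, hM, hT⟩ := h γ hγ hγ1 K
  exact ⟨reg, Uk, UkH, hU0, hUs, 𝔖, 𝔄, hR.toV4_T3 (hγ1 := hγ1), hM, hT⟩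

/-- ★ **v3 ⇒ v4 FOR THE RECORD-PARAMETRIC χ-SOCKETS**: `AlphaInputsT3ACv3RecChi L → AlphaInputsT3ACv4RecChi L` — the registered v3 stub text implies the v4 text; every landed v3
display∕door therefore also feeds v4 (nothing lost); the converse fails (that is the point of R-ii). [cite: Balaban1985UV3, (67)–(71) p.273 + Thm 2 p.272] -/
theorem alphaInputsT3ACv4RecChi_of_v3 {L : ℕ} (h : AlphaInputsT3ACv3RecChi L) : AlphaInputsT3ACv4RecChi L := by
  obtain ⟨b₁, p₁, h⟩ := h
  refine ⟨b₁, p₁, fun b₀ p₀ hb hp => ?_⟩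
  obtain ⟨𝔠, a₀, a₁, h1, h2, h3, h4, h5, hO⟩ := h b₀ p₀ hb hp
  exact ⟨𝔠, a₀, a₁, h1, h2, h3, h4, h5, fun F hF => AlphaInputsT3AC.ofV4ChiAt_of_v3 (hO F hF)⟩

end Summit.QuantumFields.YangMills.Theorems

end
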